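import Mathlib
import Summits.Ventures.PercRepro2.PMK5Deg5K6
import Summits.Ventures.PercRepro2.PMTypedDict

/-!
# THE EQUALITY LOCUS OF (HCOV) ON `K₆` — THE BERNSTEIN FORM, THE FACES, THE FIVE CLASSES, AND THE TWO
ABSTRACT HALVES (blind cell PercRepro2, mine-2 g32; the lens «equality locus first» one rung above Theorems
24 / 25 (`PMK5LocusFiveClass`, `PMK5LocusFiveClass6`): every edge set of `K₆`, on Theorem 30's certificate
(`PMK5Deg5K6`, `Deg5.cert_k6`, `Six.litOK_k6`))

`K₆` in the edge order of `PMK5Deg5Kernel.lean` (`o = 0, a₁ = 1, a₂ = 2, u = 3, b = 4, a₃ = 5`; edges `0..9` the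
lexicographic pairs of `K₅ = K₆[0..4]`, edges `10..14` the `a₃`-edges `a₃o, a₃a₁, a₃a₂, a₃u, a₃b`); an edge set
is a bitmask `M < 2^15`, its FACE the weight vectors supported on it (`p_e = 0` off `M`), its INTERIOR those with
`0 < p_e < 1` on `M`, its CENTRE `½ · 1_M`.

* **`gc15_eq_bern`**: `Gc p ends15 0 1 2 5 4 = Σ_k bern p k · (cntPos15 k − cntNeg15 k)` — the crux functional
  in the degree-3 tensor-Bernstein basis with the signed `K₃` class sums as coefficients (`hcov_cubic`,
  `triSum_empty_eq_bern`, `fullCount_eq_typedCount`, `typedCount_K3_eq`), all of them `≥ 0` by Theorem 30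
  (`coef15_nonneg`).
* **`gc15_pos_of_witness`**: a profile supported inside `M` with a strictly positive class sum makes `Gc > 0`
  at every interior weight vector of `M`; **`gc15_zero_of_centre`**: `Gc = 0` at the centre of `M` makes every
  coefficient supported inside `M` vanish (`coef15_eq_of_centre`), hence `Gc = 0` on the whole face of `M`.
* **`FiveClass15`**: the lead's five exact-zero classes of LEAD-SEP3.md Theorem 8.1 read on the six-vertex
  marked graph `K₆(M)` (`Trivial15`, `Sep2_15`, `Sep3_15`, `Sep3'_15`, `A3O15`, `OneRoot15`, `OneRoot'15`),
  in this edge order, on `PMK5Deg5Kernel.lean`'s bitmask connectivity `conn`.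
The witnesses, the maximal faces and the two «iff»s are in the files `PMK5Deg5Locus*` that follow.  Standard axioms.
-/

namespace Summit.Ventures.PercRepro2

open Hub CovForm

namespace Deg5

namespace Locus

/-! ## The Bernstein form of the crux functional on `K₆` -/

section Bern

variable {R : Type*} [Field R] [LinearOrder R] [IsStrictOrderedRing R]

/-- **The crux functional `Gc` on `K₆` in the degree-3 Bernstein basis**, coefficients the signed class sums
of `K₃` (`cntPos15 k − cntNeg15 k`, the digits of Theorem 30's slice certificate). -/
theorem gc15_eq_bern (p : Fin 15 → R) :
    Gc p ends15 0 1 2 5 4 =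
      ∑ k, bern p k * (((Six.cntPos15 k : ℕ) : R) - ((Six.cntNeg15 k : ℕ) : R)) := by
  rw [hcov_cubic p ends15 0 1 2 5 4 (fun _ => 0), PMTyped.triSum_empty_eq_bern]
  refine Finset.sum_congr rfl fun k _ => ?_
  rw [PMTyped.fullCount_eq_typedCount _ (fun _ => false),
    typedCount_K3_eq Finset.univ (fun _ => false) (fun e => (k e : ℕ)) k (fun e => by simp)]

/-- **Every Bernstein coefficient of `Gc` on `K₆` is nonnegative** — Theorem 30's certificate read digitwise. -/
theorem coef15_nonneg (k : Fin 15 → Fin 4) : Six.cntNeg15 k ≤ Six.cntPos15 k :=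
  cntNeg15_le_cntPos15 Six.litOK_k6 cert_k6 k

end Bern

/-! ## Faces of the cube, the centre of a face -/

section Face

variable {R : Type*} [Field R] [LinearOrder R] [IsStrictOrderedRing R]

/-- The centre of the face `M`: weight `1/2` on the edges of `M`, `0` off `M`. -/
def centre (M : ℕ) : Fin 15 → R := fun e => if M.testBit e = true then (1 / 2 : R) else 0

omit [LinearOrder R] [IsStrictOrderedRing R] in
/-- The centre vanishes off `M`. -/
lemma centre_off {M : ℕ} {e : Fin 15} (he : M.testBit e = false) : centre (R := R) M e = 0 := by
  unfold centre
  rw [he]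
  exact if_neg Bool.false_ne_true

omit [LinearOrder R] [IsStrictOrderedRing R] in
/-- The centre is `1/2` on `M`. -/
lemma centre_on {M : ℕ} {e : Fin 15} (he : M.testBit e = true) : centre (R := R) M e = 1 / 2 := by
  unfold centre
  rw [he]
  exact if_pos rfl

/-- The centre is interior on `M`. -/
lemma centre_on_pos {M : ℕ} {e : Fin 15} (he : M.testBit e = true) :
    0 < centre (R := R) M e ∧ centre (R := R) M e < 1 := by
  rw [centre_on he]
  exact ⟨one_half_pos, one_half_lt_one⟩

/-- The centre is an admissible weight vector. -/
lemma centre_01 (M : ℕ) (e : Fin 15) : 0 ≤ centre (R := R) M e ∧ centre (R := R) M e ≤ 1 := by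
  rcases Bool.eq_false_or_eq_true (M.testBit e) with h | h
  · rw [centre_on h]; exact ⟨one_half_pos.le, one_half_lt_one.le⟩
  · rw [centre_off h]; exact ⟨le_rfl, zero_le_one⟩

/-- A weight vector interior on `M` is admissible. -/
lemma face_01 {p : Fin 15 → R} {M : ℕ} (hp₁ : ∀ e : Fin 15, M.testBit e = true → 0 < p e ∧ p e < 1)
    (hp₀ : ∀ e : Fin 15, M.testBit e = false → p e = 0) (e : Fin 15) : 0 ≤ p e ∧ p e ≤ 1 := by
  by_cases he : M.testBit e = true
  · exact ⟨(hp₁ e he).1.le, (hp₁ e he).2.le⟩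
  · rw [hp₀ e (by simpa using he)]
    exact ⟨le_rfl, zero_le_one⟩

/-- The Bernstein basis function of a profile supported inside `M` is positive at every weight vector
interior on `M`. -/
lemma bern_pos_of_face {p : Fin 15 → R} {M : ℕ} (hp₁ : ∀ e : Fin 15, M.testBit e = true → 0 < p e ∧ p e < 1)
    (hp₀ : ∀ e : Fin 15, M.testBit e = false → p e = 0) (k : Fin 15 → Fin 4)
    (hk : ∀ e : Fin 15, k e ≠ 0 → M.testBit e = true) : 0 < bern p k := by
  unfold bern
  refine Finset.prod_pos fun e _ => ?_
  by_cases he : M.testBit e = true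
  · exact mul_pos (pow_pos (hp₁ e he).1 _) (pow_pos (sub_pos.2 (hp₁ e he).2) _)
  · have hk0 : k e = 0 := by
      by_contra h
      exact he (hk e h)
    rw [hp₀ e (by simpa using he), hk0]
    simp

omit [LinearOrder R] [IsStrictOrderedRing R] in
/-- The Bernstein basis function of a profile NOT supported inside `M` vanishes at every weight vector
supported on `M`. -/
lemma bern_eq_zero_of_face {p : Fin 15 → R} {M : ℕ} (hp₀ : ∀ e : Fin 15, M.testBit e = false → p e = 0)
    (k : Fin 15 → Fin 4) (hk : ¬ ∀ e : Fin 15, k e ≠ 0 → M.testBit e = true) : bern p k = 0 := by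
  obtain ⟨e, he⟩ := not_forall.1 hk
  obtain ⟨hke, hme⟩ := Classical.not_imp.1 he
  have hpe : p e = 0 := hp₀ e (by simpa using hme)
  unfold bern
  apply Finset.prod_eq_zero (Finset.mem_univ e)
  rw [hpe, zero_pow (fun h => hke (Fin.ext (by simpa using h)))]
  simp

/-- **THE POSITIVE SIDE FROM A WITNESS**: a profile `k` supported inside `M` with a strictly positive class
sum makes `Gc p ends15 0 1 2 5 4` strictly positive at every weight vector interior on `M`. -/
theorem gc15_pos_of_witness (M : ℕ) (k : Fin 15 → Fin 4) (hk : ∀ e : Fin 15, k e ≠ 0 → M.testBit e = true)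
    (hc : Six.cntNeg15 k < Six.cntPos15 k) (p : Fin 15 → R)
    (hp₁ : ∀ e : Fin 15, M.testBit e = true → 0 < p e ∧ p e < 1)
    (hp₀ : ∀ e : Fin 15, M.testBit e = false → p e = 0) :
    0 < Gc p ends15 0 1 2 5 4 := by
  rw [gc15_eq_bern]
  have hb : 0 < bern p k := bern_pos_of_face hp₁ hp₀ k hk
  calc (0 : R) < bern p k * (((Six.cntPos15 k : ℕ) : R) - ((Six.cntNeg15 k : ℕ) : R)) := by
        apply mul_pos hb
        rw [sub_pos]
        exact_mod_cast hc
    _ ≤ ∑ k, bern p k * (((Six.cntPos15 k : ℕ) : R) - ((Six.cntNeg15 k : ℕ) : R)) :=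
        Finset.single_le_sum
          (f := fun k => bern p k * (((Six.cntPos15 k : ℕ) : R) - ((Six.cntNeg15 k : ℕ) : R)))
          (fun k _ => mul_nonneg (bern_nonneg (face_01 hp₁ hp₀) k)
            (by rw [sub_nonneg]; exact_mod_cast coef15_nonneg k))
          (Finset.mem_univ _)

/-- **Every coefficient supported inside a face on whose centre `Gc` vanishes is zero** (the coefficients are
`≥ 0` and the Bernstein basis is positive inside the face). -/
theorem coef15_eq_of_centre (M : ℕ) (h0 : Gc (centre (R := R) M) ends15 0 1 2 5 4 = 0)
    (k : Fin 15 → Fin 4) (hk : ∀ e : Fin 15, k e ≠ 0 → M.testBit e = true) :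
    Six.cntPos15 k = Six.cntNeg15 k := by
  rw [gc15_eq_bern] at h0
  have hterm : ∀ k' ∈ (Finset.univ : Finset (Fin 15 → Fin 4)),
      0 ≤ bern (centre (R := R) M) k' * (((Six.cntPos15 k' : ℕ) : R) - ((Six.cntNeg15 k' : ℕ) : R)) :=
    fun k' _ => mul_nonneg (bern_nonneg (centre_01 M) k')
      (by rw [sub_nonneg]; exact_mod_cast coef15_nonneg k')
  have hz := (Finset.sum_eq_zero_iff_of_nonneg hterm).1 h0 k (Finset.mem_univ k)
  have hb : 0 < bern (centre (R := R) M) k :=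
    bern_pos_of_face (fun e he => centre_on_pos he) (fun e he => centre_off he) k hk
  rcases mul_eq_zero.1 hz with h | h
  · exact absurd h hb.ne'
  · have := sub_eq_zero.1 h
    exact_mod_cast this

/-- **THE ZERO SIDE FROM THE CENTRE**: if `Gc` vanishes at the centre of `M`, it vanishes at every weight
vector supported on `M`. -/
theorem gc15_zero_of_centre (M : ℕ) (h0 : Gc (centre (R := R) M) ends15 0 1 2 5 4 = 0)
    (p : Fin 15 → R) (hp₀ : ∀ e : Fin 15, M.testBit e = false → p e = 0) :
    Gc p ends15 0 1 2 5 4 = 0 := by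
  rw [gc15_eq_bern]
  refine Finset.sum_eq_zero fun k _ => ?_
  by_cases hk : ∀ e : Fin 15, k e ≠ 0 → M.testBit e = true
  · rw [coef15_eq_of_centre M h0 k hk, sub_self, mul_zero]
  · rw [bern_eq_zero_of_face hp₀ k hk, zero_mul]

end Face

/-! ## The five exact-zero classes of Theorem 8.1 on `K₆(M)` -/

/-- The open configuration of the edge set `M` of `K₆`. -/
def cfg15 (M : ℕ) : Fin 15 → Bool := fun e => M.testBit e

/-- The open configuration of `M` with every edge at the vertex `r` removed. -/
def cfgAvoid15 (M r : ℕ) : Fin 15 → Bool := fun e => M.testBit e && !(ea e == r) && !(eb e == r)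

/-- The open configuration of `M` with every edge at `r` or at `s` removed. -/
def cfgAvoid2_15 (M r s : ℕ) : Fin 15 → Bool :=
  fun e => M.testBit e && !(ea e == r) && !(eb e == r) && !(ea e == s) && !(eb e == s)

/-- The trivial class: `o` or `b` in a component containing neither root. -/
def Trivial15 (M : ℕ) : Bool :=
  (!conn (cfg15 M) 0 1 && !conn (cfg15 M) 0 2) || (!conn (cfg15 M) 4 1 && !conn (cfg15 M) 4 2)

/-- (SEP-2): `{a₁, a₂}` separates `o` from `b`. -/
def Sep2_15 (M : ℕ) : Bool := !conn (cfgAvoid2_15 M 1 2) 0 4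

/-- (SEP-3): `{a₁, a₃}` separates `o` from `a₂` and from `b`. -/
def Sep3_15 (M : ℕ) : Bool :=
  !conn (cfgAvoid2_15 M 1 5) 0 2 && !conn (cfgAvoid2_15 M 1 5) 0 4

/-- (SEP-3), the mirror: `{a₂, a₃}` separates `o` from `a₁` and from `b`. -/
def Sep3'_15 (M : ℕ) : Bool :=
  !conn (cfgAvoid2_15 M 2 5) 0 1 && !conn (cfgAvoid2_15 M 2 5) 0 4

/-- (A3-O): `a₃` alone separates `o` from both roots. -/
def A3O15 (M : ℕ) : Bool := !conn (cfgAvoid15 M 5) 0 1 && !conn (cfgAvoid15 M 5) 0 2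

/-- (ONE-ROOT): `a₂` separates `a₁` from `o`, `b` and `a₃`. -/
def OneRoot15 (M : ℕ) : Bool :=
  !conn (cfgAvoid15 M 2) 1 0 && !conn (cfgAvoid15 M 2) 1 4 && !conn (cfgAvoid15 M 2) 1 5

/-- (ONE-ROOT), the mirror: `a₁` separates `a₂` from `o`, `b` and `a₃`. -/
def OneRoot'15 (M : ℕ) : Bool :=
  !conn (cfgAvoid15 M 1) 2 0 && !conn (cfgAvoid15 M 1) 2 4 && !conn (cfgAvoid15 M 1) 2 5

/-- **The five exact-zero classes of Theorem 8.1 on the six-vertex marked graph `K₆(M)`** (marks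
`o = 0, a₁ = 1, a₂ = 2, a₃ = 5, b = 4`, the vertex `3` unmarked). -/
def FiveClass15 (M : ℕ) : Bool :=
  Trivial15 M || Sep2_15 M || Sep3_15 M || Sep3'_15 M || A3O15 M || OneRoot15 M || OneRoot'15 M

/-- `K₆` itself is in none of the classes. -/
theorem fiveClass15_full : FiveClass15 32767 = false := by decide +kernel

end Locus

end Deg5

end Summit.Ventures.PercRepro2
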